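import Literature.Analysis.Pluripotential.MollifierSubMeanValue
import HarnessLib

/-!
# Convergence of the Levi matrices of mollifications on the `C²` locus

Topic `Literature/Analysis/Pluripotential`; step (P4b) of the proof of the named fact
`BoucksomEtAl2010_regularMass_le_degree_pow` (`NonPluripolarMongeAmpereMass.lean`). For
`g : ℂᴺ → ℝ` of class `C²` at every point of an open set `Ω` and normed bumps `ρ_i = (φ i).normed`
with outer radii `→ 0` (Mathlib `ContDiffBump`, convolution `ρ ⋆ g` with `lsmul ℝ ℝ`):

* `normed_convolution_congr` — locality: `(ρ ⋆ g)(y)` only depends on `g` on `ball y φ.rOut`;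
* `fderiv_normed_convolution_apply`, `fderiv_fderiv_normed_convolution_apply` — for a compactly
  supported `C¹`/`C²` function `G`, `D_b(ρ ⋆ G) = ρ ⋆ D_b G` and `D_aD_b(ρ ⋆ G) = ρ ⋆ D_aD_b G`
  (differentiation of `s ↦ ∫ ρ(t) G(y + sb - t) dt` under the integral sign — this avoids the
  operator-valued convolution of `HasCompactSupport.hasFDerivAt_convolution_right`);
* `exists_contDiff_two_eqOn` — a compactly supported `C²` modification `G = χ g` agreeing with
  `g` near a point of `Ω`;
* `tendsto_fderiv_fderiv_normed_convolution` — **`D²(ρ_i ⋆ g)(w)(a,b) → D²g(w)(a,b)` for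
  `w ∈ Ω`**; `tendsto_leviMatrix_normed_convolution` — hence entrywise convergence of the Levi
  matrices `leviMatrix (ρ_i ⋆ g) w → leviMatrix g w`.

## References

* [HormanderSCV1973] L. Hörmander, An introduction to complex analysis in several variables (1973),
  Thm. 2.6.3 (regularisation of psh functions); standard facts on mollifiers. Tagged folklore.
-/

noncomputable section

open scoped Topology ENNReal Convolution ContDiff ComplexOrder
open MeasureTheory Filter Set Metric Complex ContinuousLinearMap
open Literature.AlgebraicGeometry.HodgeTheory.BiextensionHeight (leviMatrix fsPotential
    heightDensity)

namespace Literature.Analysis.Pluripotential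

variable {N : ℕ}

/-- **Locality of mollification**: if `g = g'` on `ball y φ.rOut` then `(ρ ⋆ g)(y) = (ρ ⋆ g')(y)`.
[folklore] -/
theorem normed_convolution_congr (φ : ContDiffBump (0 : Fin N → ℂ)) {g g' : (Fin N → ℂ) → ℝ}
    {y : Fin N → ℂ} (h : ∀ z ∈ ball y φ.rOut, g z = g' z) :
    (φ.normed volume ⋆[lsmul ℝ ℝ, volume] g) y = (φ.normed volume ⋆[lsmul ℝ ℝ, volume] g') y := by
  simp only [convolution_def]
  refine integral_congr_ae (Eventually.of_forall fun t ↦ ?_)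
  by_cases ht : t ∈ ball (0 : Fin N → ℂ) φ.rOut
  · simp only [lsmul_apply, smul_eq_mul]
    rw [h]
    rw [mem_ball, dist_eq_norm, sub_sub_cancel_left, norm_neg]
    exact mem_ball_zero_iff.mp ht
  · have h0 : φ.normed volume t = 0 := by
      have : t ∉ Function.support (φ.normed volume) := by rwa [φ.support_normed_eq]
      simpa using this
    simp [h0]

/-- **Directional derivatives of a mollification fall on a `C¹` compactly supported factor**:
`D_b (ρ ⋆ G)(y) = (ρ ⋆ D_b G)(y)` (differentiate `s ↦ ∫ ρ(t) G(y + sb - t) dt` under the integral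
sign). [folklore] -/
theorem fderiv_normed_convolution_apply (φ : ContDiffBump (0 : Fin N → ℂ))
    {G : (Fin N → ℂ) → ℝ} (hG : ContDiff ℝ 1 G) (hGc : HasCompactSupport G)
    (y b : Fin N → ℂ) :
    fderiv ℝ (φ.normed volume ⋆[lsmul ℝ ℝ, volume] G) y b =
      (φ.normed volume ⋆[lsmul ℝ ℝ, volume] fun z ↦ fderiv ℝ G z b) y := by
  set ρ := φ.normed volume with hρ
  have hGli : LocallyIntegrable G volume := hG.continuous.locallyIntegrable
  have hconv : ContDiff ℝ 1 (ρ ⋆[lsmul ℝ ℝ, volume] G) :=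
    φ.hasCompactSupport_normed.contDiff_convolution_left _ φ.contDiff_normed hGli
  -- a bound for `DG`
  obtain ⟨M, hM⟩ := (hG.continuous_fderiv one_ne_zero).bounded_above_of_compact_support
      (hGc.fderiv ℝ)
  -- the parametric integral `s ↦ (ρ ⋆ G)(y + s b) = ∫ ρ t G (y + s b - t) dt`
  set F : ℝ → (Fin N → ℂ) → ℝ := fun s t ↦ ρ t * G (y + s • b - t) with hF
  set F' : ℝ → (Fin N → ℂ) → ℝ := fun s t ↦ ρ t * fderiv ℝ G (y + s • b - t) b with hF'
  have hFconv : ∀ s, (ρ ⋆[lsmul ℝ ℝ, volume] G) (y + s • b) = ∫ t, F s t := fun _ ↦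
    convolution_lsmul
  have hF_int : ∀ s, Integrable (F s) volume := fun s ↦
    φ.hasCompactSupport_normed.convolutionExists_left (lsmul ℝ ℝ) φ.continuous_normed hGli (y + s
        • b)
  have hF_cont : ∀ s, Continuous (F s) := fun s ↦
    φ.continuous_normed.mul (hG.continuous.comp (continuous_const.sub continuous_id))
  have hF'_cont : Continuous (F' 0) := by
    refine φ.continuous_normed.mul ?_
    exact ((hG.continuous_fderiv one_ne_zero).comp (continuous_const.sub continuous_id)).clm_apply
      continuous_const
  have hderiv_pt : ∀ s t, HasDerivAt (fun s ↦ F s t) (F' s t) s := by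
    intro s t
    have h1 : HasDerivAt (fun s : ℝ ↦ y + s • b - t) b s := by
      simpa using ((hasDerivAt_id s).smul_const b).const_add y |>.sub_const t
    have h2 := ((hG.differentiable one_ne_zero) (y + s • b - t)).hasFDerivAt.comp_hasDerivAt s h1
    simpa [hF, hF'] using h2.const_mul (ρ t)
  have hbound : ∀ s t, ‖F' s t‖ ≤ ρ t * (M * ‖b‖) := by
    intro s t
    rw [hF', Real.norm_eq_abs, abs_mul, abs_of_nonneg (φ.nonneg_normed t)]
    refine mul_le_mul_of_nonneg_left ?_ (φ.nonneg_normed t)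
    exact (ContinuousLinearMap.le_opNorm _ _).trans
      (mul_le_mul_of_nonneg_right (hM _) (norm_nonneg _))
  have key := hasDerivAt_integral_of_dominated_loc_of_deriv_le (μ := volume) (F := F) (F' := F')
    (x₀ := (0 : ℝ)) (s := ball (0 : ℝ) 1) (bound := fun t ↦ ρ t * (M * ‖b‖))
    (ball_mem_nhds 0 one_pos) (Eventually.of_forall fun s ↦ (hF_cont s).aestronglyMeasurable)
    (hF_int 0) hF'_cont.aestronglyMeasurable
    (Eventually.of_forall fun t s _ ↦ hbound s t) ((φ.integrable_normed).mul_const _)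
    (Eventually.of_forall fun t s _ ↦ hderiv_pt s t)
  -- the same derivative through the chain rule
  have hchain : HasDerivAt (fun s : ℝ ↦ (ρ ⋆[lsmul ℝ ℝ, volume] G) (y + s • b))
      (fderiv ℝ (ρ ⋆[lsmul ℝ ℝ, volume] G) y b) 0 := by
    have h1 : HasDerivAt (fun s : ℝ ↦ y + s • b) b 0 := by
      simpa using ((hasDerivAt_id (0 : ℝ)).smul_const b).const_add y
    have h2 := ((hconv.differentiable one_ne_zero) (y + (0 : ℝ) • b)).hasFDerivAt.comp_hasDerivAt
        0 h1
    rw [zero_smul, add_zero] at h2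
    exact h2
  have huniq := hchain.unique (by simpa only [hFconv] using key.2)
  rw [huniq, convolution_lsmul]
  simp [hF', hρ]


/-- **Second directional derivatives of a mollification of a `C²` compactly supported function**:
`D_a D_b (ρ ⋆ G)(w) = (ρ ⋆ D_a D_b G)(w)`. [folklore] -/
theorem fderiv_fderiv_normed_convolution_apply (φ : ContDiffBump (0 : Fin N → ℂ))
    {G : (Fin N → ℂ) → ℝ} (hG : ContDiff ℝ 2 G) (hGc : HasCompactSupport G)
    (w a b : Fin N → ℂ) :
    fderiv ℝ (fderiv ℝ (φ.normed volume ⋆[lsmul ℝ ℝ, volume] G)) w a b =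
      (φ.normed volume ⋆[lsmul ℝ ℝ, volume] fun z ↦ fderiv ℝ (fderiv ℝ G) z a b) w := by
  have hG1 : ContDiff ℝ 1 G := hG.of_le (by norm_num)
  set hb : (Fin N → ℂ) → ℝ := fun z ↦ fderiv ℝ G z b with hhb
  have hhb1 : ContDiff ℝ 1 hb := (hG.fderiv_right (m := 1) le_rfl).clm_apply contDiff_const
  have hhbc : HasCompactSupport hb := hGc.fderiv_apply (𝕜 := ℝ) b
  have hconv : ContDiff ℝ 2 (φ.normed volume ⋆[lsmul ℝ ℝ, volume] G) :=
    φ.hasCompactSupport_normed.contDiff_convolution_left _ φ.contDiff_normed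
      hG.continuous.locallyIntegrable
  -- first derivative as a function
  have h1 : (fun y ↦ fderiv ℝ (φ.normed volume ⋆[lsmul ℝ ℝ, volume] G) y b) =
      φ.normed volume ⋆[lsmul ℝ ℝ, volume] hb :=
    funext fun y ↦ fderiv_normed_convolution_apply φ hG1 hGc y b
  have hd : DifferentiableAt ℝ (fderiv ℝ (φ.normed volume ⋆[lsmul ℝ ℝ, volume] G)) w :=
    (hconv.fderiv_right (m := 1) le_rfl).differentiable one_ne_zero w
  rw [show fderiv ℝ (fderiv ℝ (φ.normed volume ⋆[lsmul ℝ ℝ, volume] G)) w a b =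
      fderiv ℝ (fun y ↦ fderiv ℝ (φ.normed volume ⋆[lsmul ℝ ℝ, volume] G) y b) w a by
    rw [fderiv_clm_apply hd (differentiableAt_const b)]; simp, h1,
    fderiv_normed_convolution_apply φ hhb1 hhbc w a]
  congr 1
  funext z
  have hdz : DifferentiableAt ℝ (fderiv ℝ G) z :=
    (hG.fderiv_right (m := 1) le_rfl).differentiable one_ne_zero z
  rw [hhb, fderiv_clm_apply hdz (differentiableAt_const b)]
  simp

/-- **A `C²` cutoff modification**: for `g` of class `C²` at every point of an open set `Ω ∋ w`
there are `δ > 0` and a compactly supported `C²` function `G` on `ℂᴺ` with `G = g` on the closed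
ball `B̄(w, δ)` (`G = χ g` for a bump `χ` centred at `w` with support in `Ω`). [folklore] -/
theorem exists_contDiff_two_eqOn {g : (Fin N → ℂ) → ℝ} {Ω : Set (Fin N → ℂ)} (hΩ : IsOpen Ω)
    (hg : ∀ y ∈ Ω, ContDiffAt ℝ 2 g y) {w : Fin N → ℂ} (hw : w ∈ Ω) :
    ∃ δ > 0, ∃ G : (Fin N → ℂ) → ℝ, ContDiff ℝ 2 G ∧ HasCompactSupport G ∧
      ∀ y ∈ closedBall w δ, G y = g y := by
  obtain ⟨ε, hε, hball⟩ := Metric.isOpen_iff.mp hΩ w hw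
  set δ : ℝ := ε / 3 with hδ
  have hδpos : 0 < δ := by positivity
  let χ : ContDiffBump w := ⟨δ, 2 * δ, hδpos, by linarith⟩
  have hsupp : tsupport (χ : (Fin N → ℂ) → ℝ) ⊆ Ω := by
    rw [χ.tsupport_eq]
    exact (closedBall_subset_ball (show χ.rOut < ε by
      show 2 * δ < ε; rw [hδ]; linarith)).trans hball
  refine ⟨δ, hδpos, fun y ↦ χ y * g y, ?_, χ.hasCompactSupport.mul_right, fun y hy ↦ ?_⟩
  · rw [contDiff_iff_contDiffAt]
    intro y
    by_cases hy : y ∈ Ω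
    · exact χ.contDiff.contDiffAt.mul (hg y hy)
    · have hχ : (χ : (Fin N → ℂ) → ℝ) =ᶠ[𝓝 y] 0 :=
        notMem_tsupport_iff_eventuallyEq.mp fun h ↦ hy (hsupp h)
      have : (fun y ↦ χ y * g y) =ᶠ[𝓝 y] fun _ ↦ 0 := by
        filter_upwards [hχ] with z hz
        simp [hz]
      exact contDiffAt_const.congr_of_eventuallyEq this
  · show χ y * g y = g y
    rw [χ.one_of_mem_closedBall hy, one_mul]

/-- **Convergence of the second derivatives of mollifications on the `C²` locus**: if `g` is
locally integrable and `C²` at every point of an open set `Ω`, then at `w ∈ Ω`,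
`D²(ρ_i ⋆ g)(w)(a, b) → D²g(w)(a, b)` along any family of normed bumps with outer radii `→ 0`
(localise to a compactly supported `C²` modification, move the derivatives onto it, and use
`ContDiffBump.convolution_tendsto_right_of_continuous`). [folklore] -/
theorem tendsto_fderiv_fderiv_normed_convolution {ι : Type*} {l : Filter ι}
    {φ : ι → ContDiffBump (0 : Fin N → ℂ)} (hφ : Tendsto (fun i ↦ (φ i).rOut) l (𝓝 0))
    {g : (Fin N → ℂ) → ℝ} {Ω : Set (Fin N → ℂ)}
    (hΩ : IsOpen Ω) (hg : ∀ y ∈ Ω, ContDiffAt ℝ 2 g y) {w : Fin N → ℂ} (hw : w ∈ Ω)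
    (a b : Fin N → ℂ) :
    Tendsto (fun i ↦ fderiv ℝ (fderiv ℝ ((φ i).normed volume ⋆[lsmul ℝ ℝ, volume] g)) w a b) l
      (𝓝 (fderiv ℝ (fderiv ℝ g) w a b)) := by
  obtain ⟨δ, hδ, G, hG, hGc, hGg⟩ := exists_contDiff_two_eqOn hΩ hg hw
  -- `g = G` near `w`, hence the second derivatives at `w` agree
  have hnear : g =ᶠ[𝓝 w] G := by
    filter_upwards [Metric.ball_mem_nhds w hδ] with y hy
    exact (hGg y (ball_subset_closedBall hy)).symm
  have hD2 : fderiv ℝ (fderiv ℝ g) w a b = fderiv ℝ (fderiv ℝ G) w a b := by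
    rw [hnear.fderiv.fderiv_eq]
  -- for small bumps, the mollifications agree near `w`
  have hsmall : ∀ᶠ i in l, (φ i).rOut < δ / 2 := hφ (Iio_mem_nhds (by positivity))
  have hev : ∀ᶠ i in l, fderiv ℝ (fderiv ℝ ((φ i).normed volume ⋆[lsmul ℝ ℝ, volume] g)) w a b =
      fderiv ℝ (fderiv ℝ ((φ i).normed volume ⋆[lsmul ℝ ℝ, volume] G)) w a b := by
    filter_upwards [hsmall] with i hi
    have hloc : (φ i).normed volume ⋆[lsmul ℝ ℝ, volume] g =ᶠ[𝓝 w]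
        (φ i).normed volume ⋆[lsmul ℝ ℝ, volume] G := by
      filter_upwards [Metric.ball_mem_nhds w (half_pos hδ)] with y hy
      refine normed_convolution_congr (φ i) fun z hz ↦ (hGg z ?_).symm
      rw [mem_closedBall]
      rw [mem_ball] at hy hz
      linarith [dist_triangle z y w]
    rw [hloc.fderiv.fderiv_eq]
  -- the second derivatives of `ρ_i ⋆ G` converge
  have hcont : Continuous fun z ↦ fderiv ℝ (fderiv ℝ G) z a b := by
    have h2 : Continuous (fderiv ℝ (fderiv ℝ G)) :=
      ((hG.fderiv_right (m := 1) le_rfl).continuous_fderiv one_ne_zero)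
    exact (h2.clm_apply continuous_const).clm_apply continuous_const
  have hlim := ContDiffBump.convolution_tendsto_right_of_continuous (μ := volume) hφ hcont w
  rw [hD2]
  refine (hlim.congr' ?_)
  filter_upwards [hev] with i hi
  rw [hi, fderiv_fderiv_normed_convolution_apply (φ i) hG hGc w a b]

/-- **Convergence of the Levi matrices of mollifications on the `C²` locus.** [folklore] -/
theorem tendsto_leviMatrix_normed_convolution {ι : Type*} {l : Filter ι}
    {φ : ι → ContDiffBump (0 : Fin N → ℂ)} (hφ : Tendsto (fun i ↦ (φ i).rOut) l (𝓝 0))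
    {g : (Fin N → ℂ) → ℝ} {Ω : Set (Fin N → ℂ)}
    (hΩ : IsOpen Ω) (hg : ∀ y ∈ Ω, ContDiffAt ℝ 2 g y) {w : Fin N → ℂ} (hw : w ∈ Ω)
    (p q : Fin N) :
    Tendsto (fun i ↦ leviMatrix ((φ i).normed volume ⋆[lsmul ℝ ℝ, volume] g) w p q) l
      (𝓝 (leviMatrix g w p q)) := by
  simp only [leviMatrix_apply]
  have h := fun a b ↦ tendsto_fderiv_fderiv_normed_convolution hφ hΩ hg hw a b
  have hc : Continuous fun x : ℝ ↦ (x : ℂ) := continuous_ofReal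
  refine Tendsto.div_const (Tendsto.add ?_ (Tendsto.mul ?_ tendsto_const_nhds)) 4
  · exact (hc.tendsto _).comp ((h _ _).add (h _ _))
  · exact (hc.tendsto _).comp ((h _ _).sub (h _ _))

end Literature.Analysis.Pluripotential

end
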